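import Summits.HodgeConjecture.HodgeConjecture.Theorems.K2LiuRankOneHeckeNeighboursTwo
import Summits.HodgeConjecture.HodgeConjecture.Theorems.K2LiuHeckeShellRecursion
import Literature.NumberTheory.Automorphic.ContractingTransversalTransport
import Literature.NumberTheory.Automorphic.AdicCompletionCompact
import Literature.NumberTheory.Automorphic.Liu2021.LemD1AsPrintedIndexedNonVacuityInertFrobenius
import Literature.RingTheory.DiscreteValuationRing.AdicCompletionResidueField
import Literature.NumberTheory.GaloisRepresentations.IntegralGaloisAction

/-!
# The hyperspecial Hecke recursion in `G_v = U(V)(L⁺_v)` at an INERT unramified place: `[K_v t₁ᵐ K_v] u = μ_m u`,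
# `#(K_v t₁ᵐ K_v ∕ K_v) = (q_v + 1) q_v^{2m−1}` (LOCAL SEAM of s23, inert package, organ (26-n) H3a)

Track B ∕ K2-LIT, hLiu418 = stmt-HodgeConjecture-24832; inert package of the local seam of s23 (words
`K2/K2Liu-p01/g3/INERT-SOCKETS-v2.K2Liup01g3.md` §0–§1, plan `PLAN-28i-row26.K2Liup01g3.md`). Helper (count-neutral, own head per LEAD R3):
the TRANSPORT of the `J₀`-model results ★ `K2LiuRankOneHeckeNeighboursTwo.exists_contractingTransversal_unitary_two` (H2) and ★
`K2LiuHeckeShellRecursion.heckeOperator_pow_apply_eq_smul_of_contracting` (H1) to the K2Lit CURVE datum. For `V = ⟨dV⟩` (`N = 2`), a finite place `v`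
of `L⁺` INERT (`c w = w`) and UNRAMIFIED in `L`, a `σ_w`-fixed uniformizer `ϖ`, an integral hyperbolic frame `T ∈ GL₂(𝒪_w)` of the place form
(`diag(dV)_w = σ_w(T)ᵀ·antidiag(1,1)·T`, ★ K1⁺) and a generator `t₁ ∈ G_v` with `(t₁)_w = T⁻¹·diag(ϖ, ϖ⁻¹)·T` (★ p857060 `exists_generator_inert`):

* §1 `Ψ = (T·T⁻¹) ∘ ★ localPiNonsplitEquiv : G_v ≃* U(σ_w, J₀)(L_w)` maps `K_v = ★ localInt` onto `K₀ = unitaryInt` and `t₁` to `diag(ϖ, ϖ⁻¹)`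
  (`exists_frameEquiv_inert`), `σ_w ≠ id`, `#𝓀[L_w] = q_v²`;
* §2 **`exists_contractingTransversal_inert`** — the Hecke-neighbour datum of `(G_v, K_v, t₁)` pulled back along `Ψ` (★ `ContractingTransversalTransport`):
  `K_N ≤ K_v` contracted by `t₁`, `t₁⁻¹ ∈ K_v t₁ K_v`, pairwise disjoint shells, a transversal `X₊ ∪ X₀ ∪ {t₁⁻¹}` of `K_v t₁ K_v ∕ K_v` with
  `|X₊| = q_v²`, `|X₀| = q_v − 1`;
* §3 **`heckeOperator_pow_apply_eq_smul_inert`** — for ANY representation `ρ` of `G_v` over a commutative ring and `u ∈ V^{K_v}` with `[K_v t₁ K_v] u = a₁ u`: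
  `[K_v t₁ᵐ K_v] u = μ_m u`, `μ₀ = 1, μ₁ = a₁, μ₂ = (a₁ − q_v + 1)a₁ − q_v(q_v+1), μ_{n+3} = (a₁ − q_v + 1)μ_{n+2} − q_v²μ_{n+1}` — the recursion of ★
  `K2LiuCartanSeriesU11Closed.cartanSeriesU11_closed_form`; and **`ncard_orbit_pow_inert`**: `#(K_v t₁ᵐ K_v ∕ K_v) = 1, (q_v+1) q_v (q_v²)^{m−1}`
  (★ `SphericalCoefficient.card_orbit_pow_eq`), the volumes of #28i's majorant.
[BruhatTits1972, (4.4.3)–(4.4.4)]; [Macdonald1971, Ch. V §3 (3.9)]; [SerreTrees1980, II.1.1]; [CartierCorvallis1979, §IV.1]. No `def`, no `sorry`.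
HONEST LABEL: HC_CM is proved only modulo the printed citations (2 remaining named inputs: hLiu418 = stmt-HodgeConjecture-24832, h413 =
stmt-HodgeConjecture-24833) until rung 0 closes; this file is unconditional and moves no counter.
-/

set_option autoImplicit false

set_option linter.dupNamespace false

noncomputable section

open scoped Matrix Pointwise Valued
open NumberField IsDedekindDomain Matrix MulAction

namespace Summit.HodgeConjecture.HodgeConjecture.Cruxes.HLiu418.K2LiuInertHeckeRecursion

open Literature.NumberTheory.Automorphic Literature.NumberTheory.Automorphic.UnitaryGroup Literature.NumberTheory.Automorphic.HermitianLattice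
open Literature.NumberTheory.Automorphic.CartanUnique Literature.NumberTheory.Automorphic.SphericalCoefficient
open Literature.NumberTheory.GelbartRogawski1991 Literature.NumberTheory.GelbartRogawski1991.GRConstruction
open Literature.NumberTheory.GaloisRepresentations
open Summit.HodgeConjecture.HodgeConjecture.Cruxes.HLiu418.K2LiuRankOneHeckeCellsTwo
open Summit.HodgeConjecture.HodgeConjecture.Cruxes.HLiu418.K2LiuRankOneHeckeNeighboursTwo
open Summit.HodgeConjecture.HodgeConjecture.Cruxes.HLiu418.K2LiuHeckeShellRecursion

variable (L : Type) [Field L] [NumberField L] [IsCMField L]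
variable (dV : Fin 2 → L) (v : HeightOneSpectrum (𝓞 (Fp L)))

/-! ## §1 The frame isomorphism `Ψ : G_v ≃* U(σ_w, J₀)(L_w)` and the residue data of an inert place -/

/-- **The frame isomorphism at an inert place**: `Ψ = (T·T⁻¹) ∘ localPiNonsplitEquiv : G_v ≃* U(σ_w, J₀)(L_w)` with
`(Ψ g : GL₂) = T g_w T⁻¹`, `g ∈ K_v ↔ Ψ g ∈ K₀` (`T ∈ GL₂(𝒪_w)`), and `(Ψ t₁ : GL₂) = diag(ϖ, ϖ⁻¹)` (as in ★ p857060).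
[cite: BruhatTits1972, (4.4.3)] [cite: PlatonovRapinchuk1994, §5.1] -/
theorem exists_frameEquiv_inert (w : UnitaryGroup.PlacesOver L v) (hw : IsCMField.complexConj L • w.1 = w.1)
    {ϖ : w.1.adicCompletion L} (hϖ : Valued.v ϖ = WithZero.exp (-1 : ℤ))
    (T : GL (Fin 2) (w.1.adicCompletion L)) (hTi : T ∈ glInt 2 (w.1.adicCompletion L))
    (hTJ : UnitaryGroup.placeForm (Matrix.diagonal dV) w.1 =
      formCongr (galAdicCompletionMap (L := L) (IsCMField.complexConj L) hw) T ((StdForm.antidiagonal 2).over (w.1.adicCompletion L)))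
    (t₁ : UnitaryGroup.localPi L (IsCMField.complexConj L) 2 (Matrix.diagonal dV) v)
    (ht₁ : Units.val ((t₁ : UnitaryGroup.LocalGLPi L 2 v) w) =
      ((T⁻¹ : GL (Fin 2) (w.1.adicCompletion L)) : Matrix (Fin 2) (Fin 2) (w.1.adicCompletion L)) *
        Matrix.diagonal ![ϖ, ϖ⁻¹] * (T : Matrix (Fin 2) (Fin 2) (w.1.adicCompletion L))) :
    ∃ Ψ : UnitaryGroup.localPi L (IsCMField.complexConj L) 2 (Matrix.diagonal dV) v ≃*
        unitaryGroupOfForm (galAdicCompletionMap (L := L) (IsCMField.complexConj L) hw) ((StdForm.antidiagonal 2).over (w.1.adicCompletion L)),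
      (∀ g, g ∈ UnitaryGroup.localInt L (IsCMField.complexConj L) 2 (Matrix.diagonal dV) v ↔
        Ψ g ∈ unitaryInt (galAdicCompletionMap (L := L) (IsCMField.complexConj L) hw) ((StdForm.antidiagonal 2).over (w.1.adicCompletion L))) ∧
      ((Ψ t₁ : unitaryGroupOfForm (galAdicCompletionMap (L := L) (IsCMField.complexConj L) hw) ((StdForm.antidiagonal 2).over (w.1.adicCompletion L))) :
          GL (Fin 2) (w.1.adicCompletion L)) = zpowDiagGL (uniformizer_ne_zero hϖ) ![(1 : ℤ), -1] := by
  haveI : Algebra.IsQuadraticExtension (Fp L) L := IsCMField.isQuadraticExtension L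
  have hc : IsCMField.complexConj L ≠ 1 := IsCMField.complexConj_ne_one L
  set σ : w.1.adicCompletion L →+* w.1.adicCompletion L := galAdicCompletionMap (L := L) (IsCMField.complexConj L) hw with hσ
  have hUU : unitaryGroupOfForm σ (UnitaryGroup.placeForm (Matrix.diagonal dV) w.1) =
      unitaryGroupOfForm σ (formCongr σ T ((StdForm.antidiagonal 2).over (w.1.adicCompletion L))) := by rw [hTJ]
  let Ψ : UnitaryGroup.localPi L (IsCMField.complexConj L) 2 (Matrix.diagonal dV) v ≃*
      unitaryGroupOfForm σ ((StdForm.antidiagonal 2).over (w.1.adicCompletion L)) :=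
    (localPiNonsplitEquiv (IsCMField.complexConj L) (Matrix.diagonal dV) hc w hw).toMulEquiv.trans
      ((MulEquiv.subgroupCongr hUU).trans (unitaryGroupOfFormCongr σ T ((StdForm.antidiagonal 2).over (w.1.adicCompletion L))).toMulEquiv)
  have hΨ : ∀ u, ((Ψ u : unitaryGroupOfForm σ ((StdForm.antidiagonal 2).over (w.1.adicCompletion L))) : GL (Fin 2) (w.1.adicCompletion L)) =
      T * (u : UnitaryGroup.LocalGLPi L 2 v) w * T⁻¹ := fun u => rfl
  have hgl : ∀ g : GL (Fin 2) (w.1.adicCompletion L), g ∈ glInt 2 (w.1.adicCompletion L) ↔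
      (∀ i j, Valued.v ((g : Matrix (Fin 2) (Fin 2) (w.1.adicCompletion L)) i j) ≤ 1) ∧
        ∀ i j, Valued.v (((g⁻¹ : GL (Fin 2) (w.1.adicCompletion L)) : Matrix (Fin 2) (Fin 2) (w.1.adicCompletion L)) i j) ≤ 1 := by
    intro g
    rw [mem_glInt_adicCompletion_iff]
    simp only [HeightOneSpectrum.mem_adicCompletionIntegers]
  refine ⟨Ψ, fun u => ?_, ?_⟩
  · rw [mem_localInt_iff_of_smul_eq (IsCMField.complexConj L) 2 (Matrix.diagonal dV) hc w hw u, mem_unitaryInt_iff, hΨ, ← hgl]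
    constructor
    · intro h; exact Subgroup.mul_mem _ (Subgroup.mul_mem _ hTi h) (Subgroup.inv_mem _ hTi)
    · intro h
      have h' := Subgroup.mul_mem _ (Subgroup.mul_mem _ (Subgroup.inv_mem _ hTi) h) hTi
      rwa [show T⁻¹ * (T * (u : UnitaryGroup.LocalGLPi L 2 v) w * T⁻¹) * T = (u : UnitaryGroup.LocalGLPi L 2 v) w by group] at h'
  · apply Units.ext
    rw [hΨ t₁, Units.val_mul, Units.val_mul, ht₁, coe_zpowDiagGL]
    have h1 : (T : Matrix (Fin 2) (Fin 2) (w.1.adicCompletion L)) * ((T⁻¹ : GL (Fin 2) (w.1.adicCompletion L)) : Matrix _ _ _) = 1 := by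
      rw [← Units.val_mul, mul_inv_cancel, Units.val_one]
    have hD : (Matrix.diagonal ![ϖ, ϖ⁻¹] : Matrix (Fin 2) (Fin 2) (w.1.adicCompletion L)) = Matrix.diagonal fun i => ϖ ^ (![(1 : ℤ), -1] i) := by
      congr 1; funext i; fin_cases i <;> simp
    calc (T : Matrix (Fin 2) (Fin 2) (w.1.adicCompletion L)) *
          (((T⁻¹ : GL (Fin 2) (w.1.adicCompletion L)) : Matrix _ _ _) * Matrix.diagonal ![ϖ, ϖ⁻¹] * (T : Matrix _ _ _)) *
          ((T⁻¹ : GL (Fin 2) (w.1.adicCompletion L)) : Matrix _ _ _)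
        = ((T : Matrix (Fin 2) (Fin 2) (w.1.adicCompletion L)) * ((T⁻¹ : GL (Fin 2) (w.1.adicCompletion L)) : Matrix _ _ _)) *
            Matrix.diagonal ![ϖ, ϖ⁻¹] *
            ((T : Matrix (Fin 2) (Fin 2) (w.1.adicCompletion L)) * ((T⁻¹ : GL (Fin 2) (w.1.adicCompletion L)) : Matrix _ _ _)) := by
          simp only [Matrix.mul_assoc]
      _ = Matrix.diagonal fun i => ϖ ^ (![(1 : ℤ), -1] i) := by rw [h1, Matrix.one_mul, Matrix.mul_one, hD]

/-- **`σ_w ≠ id`**: complex conjugation moves some `y ∈ L`, and `L → L_w` is injective. [cite: NeukirchANT1999, Ch. II §4 Prop. (4.3)] -/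
theorem exists_galAdicCompletionMap_ne (w : UnitaryGroup.PlacesOver L v) (hw : IsCMField.complexConj L • w.1 = w.1) :
    ∃ x : w.1.adicCompletion L, galAdicCompletionMap (L := L) (IsCMField.complexConj L) hw x ≠ x := by
  obtain ⟨y, hy⟩ : ∃ y : L, IsCMField.complexConj L y ≠ y :=
    not_forall.1 fun h => IsCMField.complexConj_ne_one L (AlgEquiv.ext h)
  refine ⟨((y : L) : w.1.adicCompletion L), fun h => hy ?_⟩
  rw [galAdicCompletionMap_coe_algEquiv] at h
  exact (algebraMap L (w.1.adicCompletion L)).injective h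

/-- **`#𝓀[L_w] = q_v²` at an inert unramified place** (`f(w ∣ v) = 2`, ★ `card_residueField_eq_sq`). [cite: NeukirchANT1999, Ch. I §8 Prop. (8.2)] -/
theorem natCard_residueField_eq_sq_inert (w : UnitaryGroup.PlacesOver L v) (hw : IsCMField.complexConj L • w.1 = w.1)
    (hv : Algebra.IsUnramifiedIn (𝓞 L) v.asIdeal) :
    Nat.card 𝓀[w.1.adicCompletion L] = v.residueCard ^ 2 := by
  haveI : Algebra.IsQuadraticExtension (Fp L) L := IsCMField.isQuadraticExtension L
  rw [IsDedekindDomain.HeightOneSpectrum.natCard_residueField_adicCompletion L w.1,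
    Liu2021.LemD1IndexedNonVacuityInertFrobenius.card_residueField_eq_sq L (IsCMField.complexConj L) v (IsCMField.complexConj_ne_one L) hv w hw,
    HeightOneSpectrum.residueCard_eq_card_quotient]

/-! ## §2 The Hecke-neighbour datum of `(G_v, K_v, t₁)` -/

set_option maxHeartbeats 800000 in -- measured 2026-09-04: 400000 times out at `whnf`∕`isDefEq` on the adelic unitary datum (`localPi`, `localInt`, quotient, orbits, `comap` transport); 800000 passes
/-- **THE HECKE-NEIGHBOUR DATUM OF `G_v` AT AN INERT UNRAMIFIED PLACE** — the binder list of ★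
`K2LiuHeckeShellRecursion.heckeOperator_pow_apply_eq_smul_of_contracting` for `(G_v, K_v, t₁)`: a subgroup `K_N ≤ K_v` contracted by `t₁`,
`t₁⁻¹ ∈ K_v t₁ K_v`, pairwise disjoint shells `K_v t₁ᵐ K_v`, and finite `X₊` (`x t₁⁻¹ ∈ K_N`, `|X₊| = q_v²`), `X₀` (`t₁ x t₁⁻¹ ∈ K_N`, `|X₀| = q_v − 1`) with
`X₊ ∪ X₀ ∪ {t₁⁻¹}` a transversal of `K_v t₁ K_v ∕ K_v` — ★ H2 pulled back along the frame isomorphism `Ψ` (★ `ContractingTransversalTransport`).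
[cite: BruhatTits1972, (4.4.4)] [cite: SerreTrees1980, II.1.1] [cite: Macdonald1971, Ch. V §3] -/
theorem exists_contractingTransversal_inert [DecidableEq (UnitaryGroup.localPi L (IsCMField.complexConj L) 2 (Matrix.diagonal dV) v)]
    (w : UnitaryGroup.PlacesOver L v) (hw : IsCMField.complexConj L • w.1 = w.1)
    (hv : Algebra.IsUnramifiedIn (𝓞 L) v.asIdeal)
    {ϖ : w.1.adicCompletion L} (hϖ : Valued.v ϖ = WithZero.exp (-1 : ℤ))
    (hϖσ : galAdicCompletionMap (L := L) (IsCMField.complexConj L) hw ϖ = ϖ)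
    (T : GL (Fin 2) (w.1.adicCompletion L)) (hTi : T ∈ glInt 2 (w.1.adicCompletion L))
    (hTJ : UnitaryGroup.placeForm (Matrix.diagonal dV) w.1 =
      formCongr (galAdicCompletionMap (L := L) (IsCMField.complexConj L) hw) T ((StdForm.antidiagonal 2).over (w.1.adicCompletion L)))
    (t₁ : UnitaryGroup.localPi L (IsCMField.complexConj L) 2 (Matrix.diagonal dV) v)
    (ht₁ : Units.val ((t₁ : UnitaryGroup.LocalGLPi L 2 v) w) =
      ((T⁻¹ : GL (Fin 2) (w.1.adicCompletion L)) : Matrix (Fin 2) (Fin 2) (w.1.adicCompletion L)) *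
        Matrix.diagonal ![ϖ, ϖ⁻¹] * (T : Matrix (Fin 2) (Fin 2) (w.1.adicCompletion L))) :
    ∃ (KN : Subgroup (UnitaryGroup.localPi L (IsCMField.complexConj L) 2 (Matrix.diagonal dV) v))
      (Xp X0 : Finset (UnitaryGroup.localPi L (IsCMField.complexConj L) 2 (Matrix.diagonal dV) v)),
      KN ≤ UnitaryGroup.localInt L (IsCMField.complexConj L) 2 (Matrix.diagonal dV) v ∧
      (∀ u ∈ KN, t₁ * u * t₁⁻¹ ∈ KN) ∧
      t₁⁻¹ ∈ DoubleCoset.doubleCoset t₁ (UnitaryGroup.localInt L (IsCMField.complexConj L) 2 (Matrix.diagonal dV) v : Set _)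
        (UnitaryGroup.localInt L (IsCMField.complexConj L) 2 (Matrix.diagonal dV) v) ∧
      (∀ m n : ℕ, m ≠ n → Disjoint
        (DoubleCoset.doubleCoset (t₁ ^ m) (UnitaryGroup.localInt L (IsCMField.complexConj L) 2 (Matrix.diagonal dV) v : Set _)
          (UnitaryGroup.localInt L (IsCMField.complexConj L) 2 (Matrix.diagonal dV) v))
        (DoubleCoset.doubleCoset (t₁ ^ n) (UnitaryGroup.localInt L (IsCMField.complexConj L) 2 (Matrix.diagonal dV) v : Set _)
          (UnitaryGroup.localInt L (IsCMField.complexConj L) 2 (Matrix.diagonal dV) v))) ∧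
      (∀ x ∈ Xp, x * t₁⁻¹ ∈ KN) ∧ (∀ x ∈ X0, t₁ * x * t₁⁻¹ ∈ KN) ∧
      Set.BijOn (fun x : UnitaryGroup.localPi L (IsCMField.complexConj L) 2 (Matrix.diagonal dV) v =>
          (x : UnitaryGroup.localPi L (IsCMField.complexConj L) 2 (Matrix.diagonal dV) v ⧸
            UnitaryGroup.localInt L (IsCMField.complexConj L) 2 (Matrix.diagonal dV) v))
        (Xp ∪ X0 ∪ {t₁⁻¹} : Finset _)
        (orbit (UnitaryGroup.localInt L (IsCMField.complexConj L) 2 (Matrix.diagonal dV) v)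
          (t₁ : UnitaryGroup.localPi L (IsCMField.complexConj L) 2 (Matrix.diagonal dV) v ⧸
            UnitaryGroup.localInt L (IsCMField.complexConj L) 2 (Matrix.diagonal dV) v)) ∧
      Xp.card = v.residueCard ^ 2 ∧ X0.card = v.residueCard - 1 := by
  classical
  haveI : Algebra.IsQuadraticExtension (Fp L) L := IsCMField.isQuadraticExtension L
  have hc : IsCMField.complexConj L ≠ 1 := IsCMField.complexConj_ne_one L
  set Kv := UnitaryGroup.localInt L (IsCMField.complexConj L) 2 (Matrix.diagonal dV) v with hKvdef
  set σ : w.1.adicCompletion L →+* w.1.adicCompletion L := galAdicCompletionMap (L := L) (IsCMField.complexConj L) hw with hσ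
  -- the datum of the `J₀`-model, re-based on the given uniformizer
  obtain ⟨ϖ₀, hd₀⟩ := unramifiedLocalConjDatum_adicCompletion (IsCMField.complexConj L) hc v w hw hv
  have hd : UnramifiedLocalConjDatum σ ϖ := ⟨hd₀.σσ, hd₀.vσ, hϖσ, hϖ, hd₀.trace, hd₀.norm⟩
  have hσne : ∃ x : w.1.adicCompletion L, σ x ≠ x := exists_galAdicCompletionMap_ne L v w hw
  haveI : Finite 𝓀[w.1.adicCompletion L] := finite_residueField_adicCompletion L w.1
  -- the frame isomorphism
  obtain ⟨Ψ, hKΨ, hΨt₁⟩ := exists_frameEquiv_inert L dV v w hw hϖ T hTi hTJ t₁ ht₁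
  set K₀ := unitaryInt σ ((StdForm.antidiagonal 2).over (w.1.adicCompletion L)) with hK₀def
  have hKeq : K₀.comap (Ψ : UnitaryGroup.localPi L (IsCMField.complexConj L) 2 (Matrix.diagonal dV) v →*
      unitaryGroupOfForm σ ((StdForm.antidiagonal 2).over (w.1.adicCompletion L))) = Kv := by
    ext g
    rw [Subgroup.mem_comap, MonoidHom.coe_coe]
    exact (hKΨ g).symm
  -- the datum in the model group
  have ht' : (((Ψ t₁ : unitaryGroupOfForm σ ((StdForm.antidiagonal 2).over (w.1.adicCompletion L))) : GL (Fin 2) (w.1.adicCompletion L)) =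
      zpowDiagGL (uniformizer_ne_zero hd.vϖ) ![(1 : ℤ), -1]) := hΨt₁
  obtain ⟨Xp', X0', hKN', hcontr', hsymm', hD', hXp', hX0', hX', hcardp', hcard0'⟩ :=
    exists_contractingTransversal_unitary_two hd hσne (Ψ t₁) ht'
  set KP := hd.borelLatticeU ⊓ K₀ with hKPdef
  have ht₁e : Ψ.symm (Ψ t₁) = t₁ := Ψ.symm_apply_apply t₁
  -- pull back
  refine ⟨KP.comap (Ψ : _ →* _), Xp'.image Ψ.symm, X0'.image Ψ.symm, ?_, ?_, ?_, ?_, ?_, ?_, ?_, ?_, ?_⟩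
  · rw [← hKeq]; exact Subgroup.comap_mono hKN'
  · intro u hu
    have h := conj_mem_comap_of_conj_mem Ψ hcontr' hu
    rwa [ht₁e] at h
  · have h := symm_inv_mem_doubleCoset Ψ (K' := K₀) hsymm'
    rwa [ht₁e, hKeq] at h
  · have h := disjoint_doubleCoset_pow_comap Ψ (K' := K₀) hD'
    rw [ht₁e, hKeq] at h
    exact h
  · intro x hx
    obtain ⟨x', hx', rfl⟩ := Finset.mem_image.1 hx
    rw [Subgroup.mem_comap, MonoidHom.coe_coe, map_mul, map_inv, MulEquiv.apply_symm_apply]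
    exact hXp' x' hx'
  · intro x hx
    obtain ⟨x', hx', rfl⟩ := Finset.mem_image.1 hx
    rw [Subgroup.mem_comap, MonoidHom.coe_coe, map_mul, map_mul, map_inv, MulEquiv.apply_symm_apply]
    exact hX0' x' hx'
  · have hXset : ((Xp'.image Ψ.symm ∪ X0'.image Ψ.symm ∪ {t₁⁻¹} : Finset _) : Set _) =
        Ψ.symm '' ((Xp' ∪ X0' ∪ {(Ψ t₁)⁻¹} : Finset _) : Set _) := by
      rw [Finset.coe_union, Finset.coe_union, Finset.coe_image, Finset.coe_image, Finset.coe_singleton, Finset.coe_union,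
        Finset.coe_union, Finset.coe_singleton, Set.image_union, Set.image_union, Set.image_singleton, map_inv, ht₁e]
    have h := bijOn_coe_orbit_preimage Ψ (K' := K₀) hX'
    rw [ht₁e, hKeq] at h
    rw [hXset]
    exact h
  · rw [Finset.card_image_of_injective _ Ψ.symm.injective, hcardp', natCard_residueField_eq_sq_inert L v w hw hv]
  · rw [Finset.card_image_of_injective _ Ψ.symm.injective, hcard0', natCard_residueField_eq_sq_inert L v w hw hv, Nat.sqrt_eq']

/-! ## §3 The recursion and the shell sizes in `G_v` -/

set_option maxHeartbeats 400000 in -- measured 2026-09-04: default 200000 times out at `whnf`∕`isDefEq` on the adelic unitary datum (`localPi`, `localInt`, quotient, orbits); 400000 passes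
/-- **THE HYPERSPECIAL HECKE RECURSION IN `G_v` AT AN INERT UNRAMIFIED PLACE**: for any representation `ρ` of `G_v = U(V)(L⁺_v)` over a
commutative ring and `u ∈ V^{K_v}` with `[K_v t₁ K_v] u = a₁ u` (`(t₁)_w = T⁻¹·diag(ϖ, ϖ⁻¹)·T`), `[K_v t₁ᵐ K_v] u = μ_m u` for every `μ` with
`μ₀ = 1`, `μ₁ = a₁`, `μ₂ = (a₁ − q_v + 1)a₁ − q_v(q_v + 1)`, `μ_{n+3} = (a₁ − q_v + 1)μ_{n+2} − q_v²μ_{n+1}` (★ H1 on the datum of §2: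
`(|X₊|, |X₀|, #X) = (q_v², q_v − 1, q_v² + q_v)`). [cite: Macdonald1971, Ch. V §3 (3.9)] [cite: BruhatTits1972, (4.4.4)] [cite: CartierCorvallis1979, §IV.1 Thm. 4.1] -/
theorem heckeOperator_pow_apply_eq_smul_inert (w : UnitaryGroup.PlacesOver L v) (hw : IsCMField.complexConj L • w.1 = w.1)
    (hv : Algebra.IsUnramifiedIn (𝓞 L) v.asIdeal)
    {ϖ : w.1.adicCompletion L} (hϖ : Valued.v ϖ = WithZero.exp (-1 : ℤ))
    (hϖσ : galAdicCompletionMap (L := L) (IsCMField.complexConj L) hw ϖ = ϖ)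
    (T : GL (Fin 2) (w.1.adicCompletion L)) (hTi : T ∈ glInt 2 (w.1.adicCompletion L))
    (hTJ : UnitaryGroup.placeForm (Matrix.diagonal dV) w.1 =
      formCongr (galAdicCompletionMap (L := L) (IsCMField.complexConj L) hw) T ((StdForm.antidiagonal 2).over (w.1.adicCompletion L)))
    (t₁ : UnitaryGroup.localPi L (IsCMField.complexConj L) 2 (Matrix.diagonal dV) v)
    (ht₁ : Units.val ((t₁ : UnitaryGroup.LocalGLPi L 2 v) w) =
      ((T⁻¹ : GL (Fin 2) (w.1.adicCompletion L)) : Matrix (Fin 2) (Fin 2) (w.1.adicCompletion L)) *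
        Matrix.diagonal ![ϖ, ϖ⁻¹] * (T : Matrix (Fin 2) (Fin 2) (w.1.adicCompletion L)))
    {k W : Type*} [CommRing k] [AddCommGroup W] [Module k W]
    (ρ : Representation k (UnitaryGroup.localPi L (IsCMField.complexConj L) 2 (Matrix.diagonal dV) v) W)
    {u : W} (hu : u ∈ ρ.fixedPoints (UnitaryGroup.localInt L (IsCMField.complexConj L) 2 (Matrix.diagonal dV) v)) {a₁ : k}
    (hT : heckeOperator ρ (UnitaryGroup.localInt L (IsCMField.complexConj L) 2 (Matrix.diagonal dV) v) t₁ u = a₁ • u)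
    (μ : ℕ → k) (h0 : μ 0 = 1) (h1 : μ 1 = a₁)
    (h2 : μ 2 = (a₁ - v.residueCard + 1) * a₁ - (v.residueCard : k) * (v.residueCard + 1))
    (hrec : ∀ n, μ (n + 3) = (a₁ - v.residueCard + 1) * μ (n + 2) - (v.residueCard : k) ^ 2 * μ (n + 1)) (m : ℕ) :
    heckeOperator ρ (UnitaryGroup.localInt L (IsCMField.complexConj L) 2 (Matrix.diagonal dV) v) (t₁ ^ m) u = μ m • u := by
  classical
  set Kv := UnitaryGroup.localInt L (IsCMField.complexConj L) 2 (Matrix.diagonal dV) v with hKvdef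
  haveI : IsHeckeTriple (⊤ : Submonoid (UnitaryGroup.localPi L (IsCMField.complexConj L) 2 (Matrix.diagonal dV) v)) Kv Kv :=
    isHeckeTriple_top_of_isCompact_isOpen Kv (UnitaryGroup.isCompact_localInt L (IsCMField.complexConj L) 2 (Matrix.diagonal dV) v)
      (UnitaryGroup.isOpen_localInt L (IsCMField.complexConj L) 2 (Matrix.diagonal dV) v)
  have hfin : ∀ n : ℕ, (orbit Kv ((t₁ ^ n : UnitaryGroup.localPi L (IsCMField.complexConj L) 2 (Matrix.diagonal dV) v) :
      UnitaryGroup.localPi L (IsCMField.complexConj L) 2 (Matrix.diagonal dV) v ⧸ Kv)).Finite := fun n => finite_orbit_quotient Kv _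
  obtain ⟨KN, Xp, X0, hKN, ht, hsymm, hD, hXp, hX0, hX, hcardp, hcard0⟩ :=
    exists_contractingTransversal_inert L dV v w hw hv hϖ hϖσ T hTi hTJ t₁ ht₁
  have hq1 : 1 ≤ v.residueCard := by
    rw [HeightOneSpectrum.residueCard_eq_card_quotient]
    haveI : Finite (𝓞 (Fp L) ⧸ v.asIdeal) := Ideal.finiteQuotientOfFreeOfNeBot v.asIdeal v.ne_bot
    exact Nat.one_le_iff_ne_zero.2 Finite.card_pos.ne'
  refine heckeOperator_pow_apply_eq_smul_of_contracting ρ hfin hKN ht hsymm hD hXp hX0 hX hu hT μ h0 h1 ?_ (fun n => ?_) m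
  · rw [h2, hcardp, hcard0, Nat.cast_sub hq1, Nat.cast_pow, Nat.cast_one]; ring
  · rw [hrec n, hcardp, hcard0, Nat.cast_sub hq1, Nat.cast_pow, Nat.cast_one]; ring

set_option maxHeartbeats 400000 in -- measured 2026-09-04: default 200000 times out at `whnf`∕`isDefEq` on the adelic unitary datum (`localPi`, `localInt`, quotient, orbits); 400000 passes
/-- **THE SHELL SIZES IN `G_v`**: `#(K_v t₁ᵐ K_v ∕ K_v) = 1` (`m = 0`) and `= (q_v + 1)·q_v·(q_v·q_v)^{m−1}` (`m ≥ 1`) — ★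
`SphericalCoefficient.card_orbit_pow_eq` (double counting between consecutive shells) on the datum of §2; this is the volume
`ν(K_v t₁ᵐ K_v) = (1 + q_v⁻¹) q_v^{2m} ν(K_v)` of #28i's majorant. [cite: SerreTrees1980, II.1.1] [cite: Macdonald1971, Ch. V §3] -/
theorem ncard_orbit_pow_inert (w : UnitaryGroup.PlacesOver L v) (hw : IsCMField.complexConj L • w.1 = w.1)
    (hv : Algebra.IsUnramifiedIn (𝓞 L) v.asIdeal)
    {ϖ : w.1.adicCompletion L} (hϖ : Valued.v ϖ = WithZero.exp (-1 : ℤ))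
    (hϖσ : galAdicCompletionMap (L := L) (IsCMField.complexConj L) hw ϖ = ϖ)
    (T : GL (Fin 2) (w.1.adicCompletion L)) (hTi : T ∈ glInt 2 (w.1.adicCompletion L))
    (hTJ : UnitaryGroup.placeForm (Matrix.diagonal dV) w.1 =
      formCongr (galAdicCompletionMap (L := L) (IsCMField.complexConj L) hw) T ((StdForm.antidiagonal 2).over (w.1.adicCompletion L)))
    (t₁ : UnitaryGroup.localPi L (IsCMField.complexConj L) 2 (Matrix.diagonal dV) v)
    (ht₁ : Units.val ((t₁ : UnitaryGroup.LocalGLPi L 2 v) w) =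
      ((T⁻¹ : GL (Fin 2) (w.1.adicCompletion L)) : Matrix (Fin 2) (Fin 2) (w.1.adicCompletion L)) *
        Matrix.diagonal ![ϖ, ϖ⁻¹] * (T : Matrix (Fin 2) (Fin 2) (w.1.adicCompletion L))) (m : ℕ) :
    (orbit (UnitaryGroup.localInt L (IsCMField.complexConj L) 2 (Matrix.diagonal dV) v)
        ((t₁ ^ m : UnitaryGroup.localPi L (IsCMField.complexConj L) 2 (Matrix.diagonal dV) v) :
          UnitaryGroup.localPi L (IsCMField.complexConj L) 2 (Matrix.diagonal dV) v ⧸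
            UnitaryGroup.localInt L (IsCMField.complexConj L) 2 (Matrix.diagonal dV) v)).Finite ∧
    (orbit (UnitaryGroup.localInt L (IsCMField.complexConj L) 2 (Matrix.diagonal dV) v)
        ((t₁ ^ m : UnitaryGroup.localPi L (IsCMField.complexConj L) 2 (Matrix.diagonal dV) v) :
          UnitaryGroup.localPi L (IsCMField.complexConj L) 2 (Matrix.diagonal dV) v ⧸
            UnitaryGroup.localInt L (IsCMField.complexConj L) 2 (Matrix.diagonal dV) v)).ncard =
      if m = 0 then 1 else (v.residueCard + 1) * v.residueCard * (v.residueCard * v.residueCard) ^ (m - 1) := by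
  classical
  set Kv := UnitaryGroup.localInt L (IsCMField.complexConj L) 2 (Matrix.diagonal dV) v with hKvdef
  haveI : IsHeckeTriple (⊤ : Submonoid (UnitaryGroup.localPi L (IsCMField.complexConj L) 2 (Matrix.diagonal dV) v)) Kv Kv :=
    isHeckeTriple_top_of_isCompact_isOpen Kv (UnitaryGroup.isCompact_localInt L (IsCMField.complexConj L) 2 (Matrix.diagonal dV) v)
      (UnitaryGroup.isOpen_localInt L (IsCMField.complexConj L) 2 (Matrix.diagonal dV) v)
  have hfin : ∀ n : ℕ, (orbit Kv ((t₁ ^ n : UnitaryGroup.localPi L (IsCMField.complexConj L) 2 (Matrix.diagonal dV) v) :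
      UnitaryGroup.localPi L (IsCMField.complexConj L) 2 (Matrix.diagonal dV) v ⧸ Kv)).Finite := fun n => finite_orbit_quotient Kv _
  obtain ⟨KN, Xp, X0, hKN, ht, -, hD, hXp, hX0, hX, hcardp, hcard0⟩ :=
    exists_contractingTransversal_inert L dV v w hw hv hϖ hϖσ T hTi hTJ t₁ ht₁
  have hq1 : 1 ≤ v.residueCard := by
    rw [HeightOneSpectrum.residueCard_eq_card_quotient]
    haveI : Finite (𝓞 (Fp L) ⧸ v.asIdeal) := Ideal.finiteQuotientOfFreeOfNeBot v.asIdeal v.ne_bot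
    exact Nat.one_le_iff_ne_zero.2 Finite.card_pos.ne'
  have hsymm : t₁⁻¹ ∈ DoubleCoset.doubleCoset t₁ (Kv : Set _) Kv := (SphericalCoefficient.mk_mem_orbit_iff _).1 (hX.mapsTo (by simp))
  have hcard : (Xp ∪ X0 ∪ {t₁⁻¹}).card = (v.residueCard + 1) * v.residueCard := by
    rw [card_contractingTransversal hKN ht hD hXp hX0, hcardp, hcard0]
    obtain ⟨q, hq⟩ : ∃ q, v.residueCard = q + 1 := ⟨v.residueCard - 1, by omega⟩
    rw [hq, Nat.add_sub_cancel]; ring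
  have hreg : ∀ n, 1 ≤ n →
      {y | y ∈ Xp ∪ X0 ∪ {t₁⁻¹} ∧ t₁ ^ n * y ∈ DoubleCoset.doubleCoset (t₁ ^ (n + 1)) (Kv : Set _) Kv}.ncard = v.residueCard * v.residueCard ∧
      {y | y ∈ Xp ∪ X0 ∪ {t₁⁻¹} ∧ t₁ ^ n * y ∈ DoubleCoset.doubleCoset (t₁ ^ (n - 1)) (Kv : Set _) Kv}.ncard = 1 := fun n hn => by
    obtain ⟨e1, -, e3, -⟩ := ncard_translates_of_contracting hKN ht hD hXp hX0 hn
    exact ⟨by rw [e1, hcardp, sq], e3⟩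
  refine ⟨hfin m, ?_⟩
  rw [Set.ncard_eq_toFinset_card _ (hfin m)]
  exact card_orbit_pow_eq hfin hsymm hX hcard hreg m

end Summit.HodgeConjecture.HodgeConjecture.Cruxes.HLiu418.K2LiuInertHeckeRecursion

end
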